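import Summits.HubbardSuperconductivity.HubbardSuperconductivity.Theorems.BalabanIRBirComplexStableXYRBoundedPhase
import HarnessLib

/-!
# Core window recentring (stub `stub_coreWindowRecentring` of line `log-concave-core-bounded-phase`)

Support file for crux `BirComplexStableXYR` (stmt-HubbardSuperconductivity-14845) of route
`BalabanIR`; proves VERBATIM the registered stub `stub_coreWindowRecentring` of the crux-plan
skeleton `line-log-concave-core-bounded-phase` (registered 2026-08-16T11:20:56Z):

  for a (U1)+(N) table, `0 ≤ δ ≤ 1`, and a window configuration `φ` all of whose pairwise phase
  differences are `δ`-close to `0` MODULO `2π` (`cos δ ≤ cos(φ_w − φ_w')`), there are integer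
  shifts `m : W r → ℤ` such that the recentred configuration `φ_w − 2π m_w` has all pairwise
  differences `≤ δ` in absolute value, the same `F` (`F` is `2π`-periodic in every variable for
  integer frequencies), and the second-order Taylor remainder of `F` about the constants, written
  in the recentred variables, is at most `2·normA(c)·δ³`.

Recentring: round `(φ_w − φ_{w₀})/2π` to the nearest integer (`|x − round x| ≤ 1/2`), then use
that `cos` is strictly decreasing on `[0, π]` twice (first against the reference site, then
pairwise, where `|ψ_w − ψ_w'| ≤ 2δ ≤ 2 < π`).  The Taylor bound is
`cvxr_norm_genF_sub_taylor2_le` (file `…RBoundedPhase`) at the recentred configuration.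

No new definitions; fully proved, standard axioms.
-/

noncomputable section

namespace Summit.HubbardSuperconductivity.HubbardSuperconductivity.Theorems

namespace CoreRecentring

open scoped BigOperators
open Summit.HubbardSuperconductivity.BirComplexStableXYNegative

variable {r : ℕ}

/-- On `[-π, π]`, `cos δ ≤ cos t` with `0 ≤ δ ≤ π` forces `|t| ≤ δ`. [folklore] -/
theorem abs_le_of_cos_le_cos {t δ : ℝ} (hδ0 : 0 ≤ δ) (ht : |t| ≤ Real.pi)
    (hcos : Real.cos δ ≤ Real.cos t) : |t| ≤ δ := by
  by_contra h
  have hlt : δ < |t| := lt_of_not_ge h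
  have := Real.cos_lt_cos_of_nonneg_of_le_pi hδ0 ht hlt
  rw [Real.cos_abs] at this
  linarith

/-- `F` is invariant under integer `2π`-shifts of the window variables (integer frequencies).
[folklore] -/
theorem genF_sub_two_pi_mul_int (c : Table r) (φ : W r → ℝ) (m : W r → ℤ) :
    genF c (fun w => φ w - 2 * Real.pi * m w) = genF c φ := by
  classical
  unfold genF
  refine Finsupp.sum_congr fun n _ => ?_
  congr 1
  have hsum : (∑ w, (n w : ℝ) * (φ w - 2 * Real.pi * m w)) =
      (∑ w, (n w : ℝ) * φ w) - ((∑ w, n w * m w : ℤ) : ℝ) * (2 * Real.pi) := by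
    push_cast
    rw [Finset.sum_mul, ← Finset.sum_sub_distrib]
    refine Finset.sum_congr rfl fun w _ => ?_
    ring
  rw [hsum, Complex.ofReal_sub, mul_sub, Complex.exp_sub]
  have h1 : Complex.exp (Complex.I * ((((∑ w, n w * m w : ℤ) : ℝ) * (2 * Real.pi) : ℝ) : ℂ)) = 1 := by
    have : Complex.I * ((((∑ w, n w * m w : ℤ) : ℝ) * (2 * Real.pi) : ℝ) : ℂ) =
        ((∑ w, n w * m w : ℤ) : ℂ) * (2 * Real.pi * Complex.I) := by
      push_cast; ring
    rw [this]
    exact Complex.exp_int_mul_two_pi_mul_I _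
  rw [h1, div_one]

/-- **Registered stub `stub_coreWindowRecentring`** of line `log-concave-core-bounded-phase`
(crux stmt-HubbardSuperconductivity-14845), verbatim: recentring of a window configuration that
is `δ`-close to the constants modulo `2π`, invariance of `F`, and the cubic Taylor remainder bound
`2·normA·δ³` in the recentred variables. [folklore] -/
theorem stub_coreWindowRecentring : ∀ (r : ℕ) (c : Table r), (∀ n ∈ c.support, ∑ w, n w = 0) → c.sum (fun _ a => a) = 0 → ∀ δ : ℝ, 0 ≤ δ → δ ≤ 1 → ∀ φ : W r → ℝ, (∀ w w', Real.cos δ ≤ Real.cos (φ w - φ w')) → ∃ m : W r → ℤ, (∀ w w', |(φ w - 2 * Real.pi * m w) - (φ w' - 2 * Real.pi * m w')| ≤ δ) ∧ genF c (fun w => φ w - 2 * Real.pi * m w) = genF c φ ∧ ‖genF c φ - c.sum (fun n a => a * (Complex.I * ((∑ w, (n w : ℝ) * (φ w - 2 * Real.pi * m w) : ℝ) : ℂ) - (((∑ w, (n w : ℝ) * (φ w - 2 * Real.pi * m w)) ^ 2 / 2 : ℝ) : ℂ)))‖ ≤ 2 * normA c * δ ^ 3 := by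
  intro r c hU1 hN δ hδ0 hδ1 φ hcos
  classical
  have hπ3 : (3 : ℝ) < Real.pi := Real.pi_gt_three
  -- the integer shifts: round to the reference site `w₀` (if the window is empty, anything works)
  obtain ⟨m, hm⟩ : ∃ m : W r → ℤ, ∀ w w',
      |(φ w - 2 * Real.pi * m w) - (φ w' - 2 * Real.pi * m w')| ≤ δ := by
    rcases isEmpty_or_nonempty (W r) with hE | ⟨⟨w₀⟩⟩
    · exact ⟨fun _ => 0, fun w => (IsEmpty.false w).elim⟩
    · refine ⟨fun w => round ((φ w - φ w₀) / (2 * Real.pi)), ?_⟩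
      -- first: every recentred site is `δ`-close to the reference value `φ w₀`
      have href : ∀ w, |(φ w - 2 * Real.pi * (round ((φ w - φ w₀) / (2 * Real.pi)) : ℤ)) - φ w₀| ≤ δ := by
        intro w
        set x : ℝ := (φ w - φ w₀) / (2 * Real.pi) with hx
        have hround := abs_sub_round x
        have hxe : (φ w - 2 * Real.pi * (round x : ℤ)) - φ w₀ = 2 * Real.pi * (x - round x) := by
          rw [hx]; field_simp; ring
        refine abs_le_of_cos_le_cos hδ0 ?_ ?_
        · rw [hxe, abs_mul, abs_of_pos (by positivity : (0:ℝ) < 2 * Real.pi)]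
          nlinarith [hround, Real.pi_pos]
        · have : Real.cos ((φ w - 2 * Real.pi * (round x : ℤ)) - φ w₀) = Real.cos (φ w - φ w₀) := by
            rw [show (φ w - 2 * Real.pi * (round x : ℤ)) - φ w₀ =
                (φ w - φ w₀) - ((round x : ℤ) : ℝ) * (2 * Real.pi) by ring]
            exact Real.cos_sub_int_mul_two_pi _ _
          rw [this]; exact hcos w w₀
      -- then pairwise: `|ψ_w − ψ_w'| ≤ 2δ ≤ 2 < π` and `cos(ψ_w − ψ_w') = cos(φ_w − φ_w') ≥ cos δ`
      intro w w'
      have h1 := href w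
      have h2 := href w'
      refine abs_le_of_cos_le_cos hδ0 ?_ ?_
      · have htri : |(φ w - 2 * Real.pi * (round ((φ w - φ w₀) / (2 * Real.pi)) : ℤ)) -
            (φ w' - 2 * Real.pi * (round ((φ w' - φ w₀) / (2 * Real.pi)) : ℤ))| ≤ δ + δ := by
          have := abs_sub_le ((φ w - 2 * Real.pi * (round ((φ w - φ w₀) / (2 * Real.pi)) : ℤ)))
            (φ w₀) ((φ w' - 2 * Real.pi * (round ((φ w' - φ w₀) / (2 * Real.pi)) : ℤ)))
          rw [abs_sub_comm (φ w₀)] at this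
          linarith
        linarith
      · have : Real.cos ((φ w - 2 * Real.pi * (round ((φ w - φ w₀) / (2 * Real.pi)) : ℤ)) -
            (φ w' - 2 * Real.pi * (round ((φ w' - φ w₀) / (2 * Real.pi)) : ℤ))) =
            Real.cos (φ w - φ w') := by
          rw [show (φ w - 2 * Real.pi * (round ((φ w - φ w₀) / (2 * Real.pi)) : ℤ)) -
              (φ w' - 2 * Real.pi * (round ((φ w' - φ w₀) / (2 * Real.pi)) : ℤ)) =
              (φ w - φ w') - (((round ((φ w - φ w₀) / (2 * Real.pi)) -
                round ((φ w' - φ w₀) / (2 * Real.pi)) : ℤ) : ℝ)) * (2 * Real.pi) by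
            push_cast; ring]
          exact Real.cos_sub_int_mul_two_pi _ _
        rw [this]; exact hcos w w'
  refine ⟨m, hm, genF_sub_two_pi_mul_int c φ m, ?_⟩
  have h := cvxr_norm_genF_sub_taylor2_le c hU1 hN (fun w => φ w - 2 * Real.pi * m w) hδ0 hm
  rwa [genF_sub_two_pi_mul_int c φ m] at h

end CoreRecentring

end Summit.HubbardSuperconductivity.HubbardSuperconductivity.Theorems
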